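import Mathlib.Tactic

/-! stub-critic scratch: finite cores of the bookkeeping helpers of STUB-PLAN-stub_phiHiding3 -/

-- H1 core (promise_iff): modulo 9, "pq ≡ 1 ∧ (split ∨ (2,5) ∨ (5,2))" is "pq ≡ 1 ∧ ¬(8,8)"; no primality needed.
example : ∀ a : ℕ, a < 9 → ∀ b : ℕ, b < 9 →
    (((a * b) % 9 = 1 ∧ ((a % 3 = 1 ∧ b % 3 = 1) ∨ (a = 2 ∧ b = 5) ∨ (a = 5 ∧ b = 2))) ↔
      ((a * b) % 9 = 1 ∧ ¬ (a = 8 ∧ b = 8))) := by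
  decide

-- the six residue pairs of the full family N ≡ 1 (9): (1,1),(2,5),(4,7),(5,2),(7,4),(8,8)
example : ∀ a b : Fin 9, a * b = 1 →
    ((a = 1 ∧ b = 1) ∨ (a = 2 ∧ b = 5) ∨ (a = 4 ∧ b = 7) ∨ (a = 5 ∧ b = 2) ∨ (a = 7 ∧ b = 4) ∨
      (a = 8 ∧ b = 8)) := by
  decide

-- on the promise p ≡ q (mod 3) (H2 core): both prime residues agree mod 3 in every admitted pair
example : ∀ a : ℕ, a < 9 → ∀ b : ℕ, b < 9 →
    ((a * b) % 9 = 1 ∧ ¬ (a = 8 ∧ b = 8)) → a % 3 = b % 3 := by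
  decide

-- B2 core at level 27: both types fill every class ≡ 1 (mod 9) of (ℤ/27)ˣ (k1 had this; re-checked)
example : ∀ c : Fin 27, c.val % 9 = 1 →
    (∃ a b : Fin 27, a.val % 9 = 2 ∧ b.val % 9 = 5 ∧ a * b = c) ∧
    (∃ a b : Fin 27, a.val % 3 = 1 ∧ b.val % 3 = 1 ∧ a * b = c) := by
  decide

-- A2 / W0 at the degenerate member p = 2 (N = 10 = 2·5, inert type): minFac residue 2, -3 not a square
example : Nat.minFac 10 = 2 := by norm_num
example : Nat.minFac 91 = 7 := by norm_num
example : ¬ IsSquare (-3 : ZMod 10) := by decide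
example : IsSquare (-3 : ZMod 91) := ⟨58, by decide⟩
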